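import Summits.QuantumFields.YangMills.Theorems.IsotropyFromPowerCountingTemperedCurvatureMomentsThreePointChartBoundsPartOne

/-!
# Three-point chart bounds VIII: the `2 × 2` Gram form from product reflection positivity

Support file for stub `stub_threePointChartBounds` (B) of reshape 4 of
`Cruxes/TemperedCurvatureMoments/Lines/Sketch.lean` (crux stmt-QuantumFields-17721, line `Sketch`).
Cauchy–Schwarz for a positive semidefinite `2 × 2` Gram form, and the instantiation of product-tensor
reflection positivity on the two-term family `(λ (conj f₂∘θ ⊗ conj f₁∘θ), μ q)`.
References: Osterwalder–Schrader, Comm. Math. Phys. 31 (1973) §4.1, 42 (1975) §4; Glimm–Jaffe, Quantum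
Physics (1987) Thm. 6.1.3, §19.5. [folklore]
-/

noncomputable section

open scoped InnerProductSpace ComplexConjugate
open MeasureTheory Filter Set Complex
open _root_.Topology
open Literature.MathematicalPhysics.AQFT Literature.MathematicalPhysics.QuantumLattice
open Literature.MathematicalPhysics.QuantumFieldTheory
open scoped SchwartzMap LineDeriv
open Literature.MathematicalPhysics.QuantumLattice.SchwingerFamily (timeVec)
open Summit.QuantumFields.YangMills.Theorems.CurvatureKernel
open Summit.QuantumFields.YangMills.Cruxes.PlanarSpectralCone.TwoMirrorLightconeSlots.DiscSections (translateMulti_time_space)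

namespace Summit.QuantumFields.YangMills.Theorems.TemperedCurvatureMoments.Sketch.ThreePointChartBounds

/-! ## Part 2: disjoint pairs under diagonal product reflection positivity -/

section ProductRP

/-- **Cauchy–Schwarz from a positive semidefinite `2 × 2` Gram form**: if
`|λ|² a + λ̄ μ z + μ̄ λ z' + |μ|² d` is real and nonnegative for all `λ, μ ∈ ℂ` then `|z|² ≤ (re a)(re d)`
(and `re a, re d ≥ 0`). [folklore] -/
theorem normSq_le_of_psd2 {a d z z' : ℂ}
    (h : ∀ lam mu : ℂ, 0 ≤ (conj lam * lam * a + conj lam * mu * z + conj mu * lam * z' + conj mu * mu * d).re ∧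
      (conj lam * lam * a + conj lam * mu * z + conj mu * lam * z' + conj mu * mu * d).im = 0) :
    ‖z‖ ^ 2 ≤ a.re * d.re ∧ 0 ≤ a.re ∧ 0 ≤ d.re := by
  have h10 := h 1 0
  have h01 := h 0 1
  have h11 := (h 1 1).2
  have hm1 := (h (-1) 1).2
  have hI1 := (h Complex.I 1).2
  simp only [map_one, map_zero, map_neg, one_mul, mul_one, zero_mul, mul_zero, add_zero, zero_add,
    Complex.add_im, Complex.neg_im, Complex.mul_re, Complex.mul_im,
    Complex.conj_I, Complex.I_re, Complex.I_im, neg_mul, mul_neg, neg_neg, zero_sub,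
    one_mul] at h10 h01 h11 hm1 hI1
  obtain ⟨ha0, haim⟩ := h10
  obtain ⟨hd0, hdim⟩ := h01
  have hz'im : z'.im = -z.im := by linarith
  have hz're : z'.re = z.re := by linarith
  refine ⟨?_, ha0, hd0⟩
  set n : ℝ := z.re ^ 2 + z.im ^ 2 with hn
  have hnz : ‖z‖ ^ 2 = n := by rw [Complex.sq_norm, Complex.normSq_apply, hn]; ring
  have hG : ∀ t : ℝ, 0 ≤ t ^ 2 * n * a.re - 2 * t * n + d.re := by
    intro t
    have h1 := (h (-(z * (t : ℂ))) 1).1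
    simp only [map_one, map_neg, map_mul, Complex.conj_ofReal, one_mul, mul_one,
      Complex.add_re, Complex.neg_re, Complex.mul_re, Complex.mul_im,
      Complex.conj_re, Complex.conj_im, Complex.ofReal_re, Complex.ofReal_im, neg_mul, mul_neg, neg_neg,
      mul_zero, sub_zero, hz're, hz'im, haim] at h1
    rw [hn]
    nlinarith [h1]
  have hn0 : 0 ≤ n := by positivity
  rw [hnz]
  rcases ha0.eq_or_lt with ha | ha
  · -- `a.re = 0`: then `n = 0`
    rw [← ha, zero_mul]
    by_contra hne
    have hnp : 0 < n := lt_of_le_of_ne hn0 (fun h0 => hne (by rw [← h0]))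
    have := hG ((d.re + 1) / (2 * n))
    rw [← ha] at this
    have h2 : 2 * ((d.re + 1) / (2 * n)) * n = d.re + 1 := by field_simp
    nlinarith [this, h2]
  · have := hG (1 / a.re)
    have h2 : (1 / a.re) ^ 2 * n * a.re - 2 * (1 / a.re) * n + d.re = d.re - n / a.re := by
      field_simp; ring
    rw [h2] at this
    have h3 : n / a.re ≤ d.re := by linarith
    rwa [div_le_iff₀ ha, mul_comm] at h3

/-- Scalars in a one-slot tensor. [folklore] -/
theorem tensorFin_one_smul (c : ℂ) (q : 𝓢(EuclideanSpace ℝ (Fin 4), ℂ)) :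
    SchwartzMap.tensorFin 1 ![c • q] = c • SchwartzMap.tensorFin 1 ![q] := by
  ext x
  simp

/-- The OS adjoint of a one-slot tensor. [folklore] -/
theorem osAdjoint_tensorFin_one (q : 𝓢(EuclideanSpace ℝ (Fin 4), ℂ)) :
    osAdjoint (SchwartzMap.tensorFin 1 ![q]) = SchwartzMap.tensorFin 1 ![starTest (thetaTest 4 q)] := by
  ext x
  rw [osAdjoint_tensorFin_one_apply, tensorFin_one_eval, starTest_thetaTest_apply]

/-- `(conj q∘θ) ⊗ (a ⊗ b)` as a three-slot tensor. [folklore] -/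
theorem appendTensor_one_two (u a b : 𝓢(EuclideanSpace ℝ (Fin 4), ℂ)) :
    (SchwartzMap.tensorFin 1 ![u]).appendTensor (SchwartzMap.tensorFin 2 ![a, b]) =
      SchwartzMap.tensorFin 3 ![u, a, b] := by
  ext x
  have hc : (x ∘ Fin.castAdd 2 : Fin 1 → EuclideanSpace ℝ (Fin 4)) = ![x 0] := by
    funext i; fin_cases i; rfl
  have hn : (x ∘ Fin.natAdd 1 : Fin 2 → EuclideanSpace ℝ (Fin 4)) = ![x 1, x 2] := by
    funext i; fin_cases i <;> rfl
  rw [SchwartzMap.appendTensor_apply, hc, hn, tensorFin_one_eval, tensorFin_two_eval, tensorFin_three_eval]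
  simp [mul_assoc]

/-- Compact support of `conj f∘θ`. [folklore] -/
theorem hasCompactSupport_starTest_thetaTest {f : 𝓢(EuclideanSpace ℝ (Fin 4), ℂ)}
    (hf : HasCompactSupport (f : EuclideanSpace ℝ (Fin 4) → ℂ)) :
    HasCompactSupport ((starTest (thetaTest 4 f) : 𝓢(EuclideanSpace ℝ (Fin 4), ℂ)) :
      EuclideanSpace ℝ (Fin 4) → ℂ) := by
  have h : ((starTest (thetaTest 4 f) : 𝓢(EuclideanSpace ℝ (Fin 4), ℂ)) : EuclideanSpace ℝ (Fin 4) → ℂ) =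
      (fun z : ℂ => conj z) ∘ ((f : EuclideanSpace ℝ (Fin 4) → ℂ) ∘ (timeReflection 4).toHomeomorph) := by
    funext z; simp
  rw [h]
  exact (hf.comp_homeomorph _).comp_left (map_zero _)

/-- Compact support of a scalar multiple. [folklore] -/
theorem hasCompactSupport_smul' (c : ℂ) {f : 𝓢(EuclideanSpace ℝ (Fin 4), ℂ)}
    (hf : HasCompactSupport (f : EuclideanSpace ℝ (Fin 4) → ℂ)) :
    HasCompactSupport (((c • f : 𝓢(EuclideanSpace ℝ (Fin 4), ℂ))) : EuclideanSpace ℝ (Fin 4) → ℂ) :=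
  hf.mono' ((Function.support_const_smul_subset c (f : EuclideanSpace ℝ (Fin 4) → ℂ)).trans (subset_tsupport _))

/-- Support of a scalar multiple. [folklore] -/
theorem tsupport_smul_subset' (c : ℂ) (f : 𝓢(EuclideanSpace ℝ (Fin 4), ℂ)) :
    tsupport (((c • f : 𝓢(EuclideanSpace ℝ (Fin 4), ℂ))) : EuclideanSpace ℝ (Fin 4) → ℂ) ⊆
      tsupport (f : EuclideanSpace ℝ (Fin 4) → ℂ) :=
  tsupport_smul_subset_right (fun _ : EuclideanSpace ℝ (Fin 4) => c) (f : EuclideanSpace ℝ (Fin 4) → ℂ)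

/-- **The `2 × 2` Gram form of a disjoint pair and a one-point function from product reflection
positivity.**  For `S₀` with `(∀ (N : ℕ) (deg : Fin N → ℕ) (g : (j : Fin N) → Fin (deg j) → 𝓢(EuclideanSpace ℝ (Fin 4), ℂ))
    (F : (j : Fin N) → 𝓢((Fin (deg j) → EuclideanSpace ℝ (Fin 4)), ℂ)),
    (∀ j, IsTensorOf (F j) (g j)) →
    (∀ j i, HasCompactSupport (g j i : EuclideanSpace ℝ (Fin 4) → ℂ) ∧
      tsupport (g j i : EuclideanSpace ℝ (Fin 4) → ℂ) ⊆ {x : EuclideanSpace ℝ (Fin 4) | 0 < x 0}) →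
    (∀ j i i', i ≠ i' → Disjoint (tsupport (g j i : EuclideanSpace ℝ (Fin 4) → ℂ))
      (tsupport (g j i' : EuclideanSpace ℝ (Fin 4) → ℂ))) →
    ∀ H : (i j : Fin N) → 𝓢((Fin (deg i + deg j) → EuclideanSpace ℝ (Fin 4)), ℂ),
      (∀ i j, IsAppendTensorOf (H i j) (osAdjoint (F i)) (F j)) →
        0 ≤ (∑ i, ∑ j, S₀ (deg i + deg j) (H i j)).re ∧ (∑ i, ∑ j, S₀ (deg i + deg j) (H i j)).im = 0)`, compactly supported `f₁, f₂` with disjoint supports in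
`{y₀ < 0}` and `q` in `{y₀ > 0}`, the family `(λ (conj f₂∘θ ⊗ conj f₁∘θ), μ q)` gives
`|λ|² 𝔖₄(f₁⊗f₂⊗θf̄₂⊗θf̄₁) + λ̄μ 𝔖₃(f₁⊗f₂⊗q) + μ̄λ 𝔖₃(θq̄⊗θf̄₂⊗θf̄₁) + |μ|² 𝔖₂(θq̄⊗q) ≥ 0`. [folklore] -/
theorem psd_of_productRP (S₀ : SchwingerFamily (EuclideanSpace ℝ (Fin 4))) (hP : (∀ (N : ℕ) (deg : Fin N → ℕ) (g : (j : Fin N) → Fin (deg j) → 𝓢(EuclideanSpace ℝ (Fin 4), ℂ))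
    (F : (j : Fin N) → 𝓢((Fin (deg j) → EuclideanSpace ℝ (Fin 4)), ℂ)),
    (∀ j, IsTensorOf (F j) (g j)) →
    (∀ j i, HasCompactSupport (g j i : EuclideanSpace ℝ (Fin 4) → ℂ) ∧
      tsupport (g j i : EuclideanSpace ℝ (Fin 4) → ℂ) ⊆ {x : EuclideanSpace ℝ (Fin 4) | 0 < x 0}) →
    (∀ j i i', i ≠ i' → Disjoint (tsupport (g j i : EuclideanSpace ℝ (Fin 4) → ℂ))
      (tsupport (g j i' : EuclideanSpace ℝ (Fin 4) → ℂ))) →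
    ∀ H : (i j : Fin N) → 𝓢((Fin (deg i + deg j) → EuclideanSpace ℝ (Fin 4)), ℂ),
      (∀ i j, IsAppendTensorOf (H i j) (osAdjoint (F i)) (F j)) →
        0 ≤ (∑ i, ∑ j, S₀ (deg i + deg j) (H i j)).re ∧ (∑ i, ∑ j, S₀ (deg i + deg j) (H i j)).im = 0))
    {f₁ f₂ q : 𝓢(EuclideanSpace ℝ (Fin 4), ℂ)}
    (hf₁c : HasCompactSupport (f₁ : EuclideanSpace ℝ (Fin 4) → ℂ))
    (hf₂c : HasCompactSupport (f₂ : EuclideanSpace ℝ (Fin 4) → ℂ))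
    (hqc : HasCompactSupport (q : EuclideanSpace ℝ (Fin 4) → ℂ))
    (hf₁ : tsupport (f₁ : EuclideanSpace ℝ (Fin 4) → ℂ) ⊆ {y | y 0 < 0})
    (hf₂ : tsupport (f₂ : EuclideanSpace ℝ (Fin 4) → ℂ) ⊆ {y | y 0 < 0})
    (hq : tsupport (q : EuclideanSpace ℝ (Fin 4) → ℂ) ⊆ {y | 0 < y 0})
    (hdis : Disjoint (tsupport (f₁ : EuclideanSpace ℝ (Fin 4) → ℂ)) (tsupport (f₂ : EuclideanSpace ℝ (Fin 4) → ℂ)))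
    (lam mu : ℂ) :
    0 ≤ (conj lam * lam * S₀ 4 (SchwartzMap.tensorFin 4 ![f₁, f₂, starTest (thetaTest 4 f₂), starTest (thetaTest 4 f₁)]) +
        conj lam * mu * S₀ 3 (SchwartzMap.tensorFin 3 ![f₁, f₂, q]) +
        conj mu * lam * S₀ 3 (SchwartzMap.tensorFin 3 ![starTest (thetaTest 4 q), starTest (thetaTest 4 f₂),
          starTest (thetaTest 4 f₁)]) +
        conj mu * mu * S₀ 2 (SchwartzMap.tensorFin 2 ![starTest (thetaTest 4 q), q])).re ∧
      (conj lam * lam * S₀ 4 (SchwartzMap.tensorFin 4 ![f₁, f₂, starTest (thetaTest 4 f₂), starTest (thetaTest 4 f₁)]) +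
        conj lam * mu * S₀ 3 (SchwartzMap.tensorFin 3 ![f₁, f₂, q]) +
        conj mu * lam * S₀ 3 (SchwartzMap.tensorFin 3 ![starTest (thetaTest 4 q), starTest (thetaTest 4 f₂),
          starTest (thetaTest 4 f₁)]) +
        conj mu * mu * S₀ 2 (SchwartzMap.tensorFin 2 ![starTest (thetaTest 4 q), q])).im = 0 := by
  set φ₁ : 𝓢(EuclideanSpace ℝ (Fin 4), ℂ) := starTest (thetaTest 4 f₁) with hφ₁
  set φ₂ : 𝓢(EuclideanSpace ℝ (Fin 4), ℂ) := starTest (thetaTest 4 f₂) with hφ₂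
  have hφ₁s := tsupport_starTest_thetaTest_subset_pos hf₁
  have hφ₂s := tsupport_starTest_thetaTest_subset_pos hf₂
  have hφdis : Disjoint (tsupport (φ₂ : EuclideanSpace ℝ (Fin 4) → ℂ)) (tsupport (φ₁ : EuclideanSpace ℝ (Fin 4) → ℂ)) :=
    Set.disjoint_left.2 fun y hy2 hy1 =>
      Set.disjoint_left.1 hdis (timeReflection_mem_tsupport_of_mem_tsupport_starTest_thetaTest f₁ hy1)
        (timeReflection_mem_tsupport_of_mem_tsupport_starTest_thetaTest f₂ hy2)
  -- the two-term family
  let deg : Fin 2 → ℕ := ![2, 1]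
  let g : (j : Fin 2) → Fin (deg j) → 𝓢(EuclideanSpace ℝ (Fin 4), ℂ) := fun j =>
    match j with
    | ⟨0, _⟩ => ![lam • φ₂, φ₁]
    | ⟨1, _⟩ => ![mu • q]
  let F : (j : Fin 2) → 𝓢((Fin (deg j) → EuclideanSpace ℝ (Fin 4)), ℂ) := fun j => SchwartzMap.tensorFin (deg j) (g j)
  let H : (i j : Fin 2) → 𝓢((Fin (deg i + deg j) → EuclideanSpace ℝ (Fin 4)), ℂ) := fun i j =>
    (osAdjoint (F i)).appendTensor (F j)
  have hsupp : ∀ j i, HasCompactSupport (g j i : EuclideanSpace ℝ (Fin 4) → ℂ) ∧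
      tsupport (g j i : EuclideanSpace ℝ (Fin 4) → ℂ) ⊆ {x : EuclideanSpace ℝ (Fin 4) | 0 < x 0} := by
    intro j i
    match j, i with
    | ⟨0, _⟩, ⟨0, _⟩ =>
      exact ⟨hasCompactSupport_smul' lam (hasCompactSupport_starTest_thetaTest hf₂c),
        (tsupport_smul_subset' lam φ₂).trans hφ₂s⟩
    | ⟨0, _⟩, ⟨1, _⟩ => exact ⟨hasCompactSupport_starTest_thetaTest hf₁c, hφ₁s⟩
    | ⟨1, _⟩, ⟨0, _⟩ => exact ⟨hasCompactSupport_smul' mu hqc, (tsupport_smul_subset' mu q).trans hq⟩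
  have hdisj : ∀ j i i', i ≠ i' → Disjoint (tsupport (g j i : EuclideanSpace ℝ (Fin 4) → ℂ))
      (tsupport (g j i' : EuclideanSpace ℝ (Fin 4) → ℂ)) := by
    intro j i i' hii'
    match j, i, i' with
    | ⟨0, _⟩, ⟨0, _⟩, ⟨0, _⟩ => exact absurd rfl hii'
    | ⟨0, _⟩, ⟨0, _⟩, ⟨1, _⟩ => exact hφdis.mono_left (tsupport_smul_subset' lam φ₂)
    | ⟨0, _⟩, ⟨1, _⟩, ⟨0, _⟩ => exact hφdis.symm.mono_right (tsupport_smul_subset' lam φ₂)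
    | ⟨0, _⟩, ⟨1, _⟩, ⟨1, _⟩ => exact absurd rfl hii'
    | ⟨1, _⟩, ⟨0, _⟩, ⟨0, _⟩ => exact absurd rfl hii'
  have key := hP 2 deg g F (fun j => isTensorOf_tensorFin _) hsupp hdisj H
    (fun i j => isAppendTensorOf_appendTensor _ _)
  -- the four terms
  have hP2 : SchwartzMap.tensorFin 2 ![lam • φ₂, φ₁] = lam • SchwartzMap.tensorFin 2 ![φ₂, φ₁] :=
    tensorFin_two_smul_left lam φ₂ φ₁
  have hA00 : (osAdjoint (SchwartzMap.tensorFin 2 ![φ₂, φ₁])).appendTensor (SchwartzMap.tensorFin 2 ![φ₂, φ₁]) =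
      SchwartzMap.tensorFin 4 ![f₁, f₂, φ₂, φ₁] := by
    ext x
    rw [SchwartzMap.appendTensor_apply, (isAppendTensorOf_four f₁ f₂ x)]
  have hA01 : (osAdjoint (SchwartzMap.tensorFin 2 ![φ₂, φ₁])).appendTensor (SchwartzMap.tensorFin 1 ![q]) =
      SchwartzMap.tensorFin 3 ![f₁, f₂, q] := by
    ext x
    rw [SchwartzMap.appendTensor_apply, (isAppendTensorOf_three f₁ f₂ q x)]
  have hA10 : (osAdjoint (SchwartzMap.tensorFin 1 ![q])).appendTensor (SchwartzMap.tensorFin 2 ![φ₂, φ₁]) =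
      SchwartzMap.tensorFin 3 ![starTest (thetaTest 4 q), φ₂, φ₁] := by
    rw [osAdjoint_tensorFin_one, appendTensor_one_two]
  have hA11 : (osAdjoint (SchwartzMap.tensorFin 1 ![q])).appendTensor (SchwartzMap.tensorFin 1 ![q]) =
      SchwartzMap.tensorFin 2 ![starTest (thetaTest 4 q), q] := by
    ext x
    rw [SchwartzMap.appendTensor_apply, (isAppendTensorOf_conjTheta q q x)]
  have e00 : S₀ (deg 0 + deg 0) (H 0 0) = conj lam * lam * S₀ 4 (SchwartzMap.tensorFin 4 ![f₁, f₂, φ₂, φ₁]) := by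
    show S₀ 4 ((osAdjoint (SchwartzMap.tensorFin 2 ![lam • φ₂, φ₁])).appendTensor
      (SchwartzMap.tensorFin 2 ![lam • φ₂, φ₁])) = _
    rw [hP2, Literature.MathematicalPhysics.QuantumLattice.osAdjoint_smul, SchwartzMap.appendTensor_smul_left, SchwartzMap.appendTensor_smul_right, hA00,
      map_smul, map_smul, smul_eq_mul, smul_eq_mul, ← mul_assoc]
  have e01 : S₀ (deg 0 + deg 1) (H 0 1) = conj lam * mu * S₀ 3 (SchwartzMap.tensorFin 3 ![f₁, f₂, q]) := by
    show S₀ 3 ((osAdjoint (SchwartzMap.tensorFin 2 ![lam • φ₂, φ₁])).appendTensor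
      (SchwartzMap.tensorFin 1 ![mu • q])) = _
    rw [hP2, tensorFin_one_smul, Literature.MathematicalPhysics.QuantumLattice.osAdjoint_smul, SchwartzMap.appendTensor_smul_left,
      SchwartzMap.appendTensor_smul_right, hA01, map_smul, map_smul, smul_eq_mul, smul_eq_mul, ← mul_assoc]
  have e10 : S₀ (deg 1 + deg 0) (H 1 0) =
      conj mu * lam * S₀ 3 (SchwartzMap.tensorFin 3 ![starTest (thetaTest 4 q), φ₂, φ₁]) := by
    show S₀ 3 ((osAdjoint (SchwartzMap.tensorFin 1 ![mu • q])).appendTensor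
      (SchwartzMap.tensorFin 2 ![lam • φ₂, φ₁])) = _
    rw [hP2, tensorFin_one_smul, Literature.MathematicalPhysics.QuantumLattice.osAdjoint_smul, SchwartzMap.appendTensor_smul_left,
      SchwartzMap.appendTensor_smul_right, hA10, map_smul, map_smul, smul_eq_mul, smul_eq_mul, ← mul_assoc]
  have e11 : S₀ (deg 1 + deg 1) (H 1 1) = conj mu * mu * S₀ 2 (SchwartzMap.tensorFin 2 ![starTest (thetaTest 4 q), q]) := by
    show S₀ 2 ((osAdjoint (SchwartzMap.tensorFin 1 ![mu • q])).appendTensor (SchwartzMap.tensorFin 1 ![mu • q])) = _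
    rw [tensorFin_one_smul, Literature.MathematicalPhysics.QuantumLattice.osAdjoint_smul, SchwartzMap.appendTensor_smul_left,
      SchwartzMap.appendTensor_smul_right, hA11, map_smul, map_smul, smul_eq_mul, smul_eq_mul, ← mul_assoc]
  simp only [Fin.sum_univ_two, e00, e01, e10, e11] at key
  have hsum : conj lam * lam * S₀ 4 (SchwartzMap.tensorFin 4 ![f₁, f₂, φ₂, φ₁]) +
      conj lam * mu * S₀ 3 (SchwartzMap.tensorFin 3 ![f₁, f₂, q]) +
      (conj mu * lam * S₀ 3 (SchwartzMap.tensorFin 3 ![starTest (thetaTest 4 q), φ₂, φ₁]) +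
      conj mu * mu * S₀ 2 (SchwartzMap.tensorFin 2 ![starTest (thetaTest 4 q), q])) =
      conj lam * lam * S₀ 4 (SchwartzMap.tensorFin 4 ![f₁, f₂, φ₂, φ₁]) +
      conj lam * mu * S₀ 3 (SchwartzMap.tensorFin 3 ![f₁, f₂, q]) +
      conj mu * lam * S₀ 3 (SchwartzMap.tensorFin 3 ![starTest (thetaTest 4 q), φ₂, φ₁]) +
      conj mu * mu * S₀ 2 (SchwartzMap.tensorFin 2 ![starTest (thetaTest 4 q), q]) := by ring
  rw [hsum] at key
  exact key

end ProductRP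

end Summit.QuantumFields.YangMills.Theorems.TemperedCurvatureMoments.Sketch.ThreePointChartBounds

end
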